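import Literature.RingTheory.Derivation.MvPowerSeriesPBasisChainRule
import HarnessLib

/-!
# Crux `Steer` (stmt-ResolutionOfSingularities-16345), chain W4.1, K3ᴳ / ℓ-COMPARISON plan B file (2b): derivations of `κ⟦X⟧` EXTEND along
# `map λ : κ⟦X⟧ → κ′⟦X⟧` when the coefficient derivations do

OURS (campaign `res-hironaka`, rung L ★L-G4, slot W4.1; seat res-L0-w41-stub-2 g6; `K3G/JacobianLengthEtale-PLAN.md` f671a211d1dd908a, plan B step 2).
Theses-free, definition-free. Input (F4) of `JacobianLength.length_quotient_span_derivation_le_of_flat_unramified` (p565302) read in Cohen frames: if `κ` has a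
finite `p`-basis dual frame `(γ, D)` (`D_l γ_{l′} = δ`, `κ = κ^p(γ)`) and each `D_l` extends along `λ : κ → κ′` to a derivation `D′_l` of `κ′`
(`D′_l (λ a) = λ (D_l a)` — res-D-lib-1's `TwoBasis.exists_pFrame_of_isSeparable`, third conjunct, for finite separable `κ′/κ`), then for every `ℤ`-derivation
`Δ` of `κ⟦X⟧` and every `F`: `(map λ)(Δ F) = Δ′((map λ) F)` for the derivation `Δ′ := Σᵢ λ(Δ Xᵢ)·∂ᵢ + Σ_l λ(Δ (C γ_l))·D̃′_l` of `κ′⟦X⟧`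
(the `p`-basis chain rule `derivation_apply_eq_sum_frame`). [cite: Matsumura1987, Thm. 30.6 (i)] [folklore]

* `PowerSeriesDerivExt.map_pderiv`, `PowerSeriesDerivExt.map_mvPowerSeriesCoeffwise` — `∂ᵢ` and `D̃` commute with `map λ`;
* `PowerSeriesDerivExt.exists_derivation_map_eq` — the extension statement.
-/

noncomputable section

set_option linter.dupNamespace false

open MvPowerSeries
open Literature.RingTheory.Derivation Literature.FieldTheory.Separability Literature.AlgebraicGeometry.Resolution

namespace Summit.ResolutionOfSingularities.ResolutionOfSingularities.Theorems.SwitchingDichotomy.PowerSeriesDerivExt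

/-- `∂ᵢ` commutes with a change of coefficients. -/
theorem map_pderiv {κ κ' : Type} [CommRing κ] [CommRing κ'] (lam : κ →+* κ') {σ : Type} (i : σ) (F : MvPowerSeries σ κ) :
    MvPowerSeries.map lam (MvPowerSeries.pderiv i F) = MvPowerSeries.pderiv i (MvPowerSeries.map lam F) := by
  ext e
  rw [coeff_map, MvPowerSeries.coeff_pderiv, MvPowerSeries.coeff_pderiv, coeff_map, map_mul, map_add, map_natCast, map_one]

/-- A coefficientwise derivation commutes with a change of coefficients along which the coefficient derivation extends. -/
theorem map_mvPowerSeriesCoeffwise {κ κ' : Type} [CommRing κ] [CommRing κ'] (lam : κ →+* κ') {σ : Type}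
    {A A' : Type} [CommRing A] [CommRing A'] [Algebra A κ] [Algebra A' κ']
    (D : Derivation A κ κ) (D' : Derivation A' κ' κ') (hD : ∀ a, D' (lam a) = lam (D a)) (F : MvPowerSeries σ κ) :
    MvPowerSeries.map lam (D.mvPowerSeriesCoeffwise F) = D'.mvPowerSeriesCoeffwise (MvPowerSeries.map lam F) := by
  ext e
  rw [coeff_map, coeff_mvPowerSeriesCoeffwise, coeff_mvPowerSeriesCoeffwise, coeff_map, hD]

/-- **Derivations of `κ⟦X⟧` extend along `map λ`** (given a finite `p`-basis dual frame of `κ` whose derivations extend along `λ`): for every `ℤ`-derivation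
`Δ` of `κ⟦X⟧` there is a `ℤ`-derivation `Δ′` of `κ′⟦X⟧` with `Δ′ (λ_* F) = λ_* (Δ F)` for all `F`. [cite: Matsumura1987, Thm. 30.6 (i)] [folklore] -/
theorem exists_derivation_map_eq (p : ℕ) [Fact p.Prime] {κ κ' : Type} [Field κ] [Field κ'] [CharP κ p] (lam : κ →+* κ') {n r : ℕ}
    (γ : Fin r → κ) (D : Fin r → Derivation ℤ κ κ) (hdual : ∀ l l', D l (γ l') = if l' = l then 1 else 0)
    (hgen : pAdjoin p (Set.range γ) = ⊤)
    (D' : Fin r → Derivation ℤ κ' κ') (hD' : ∀ l a, D' l (lam a) = lam (D l a))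
    (Δ : Derivation ℤ (MvPowerSeries (Fin n) κ) (MvPowerSeries (Fin n) κ)) :
    ∃ Δ' : Derivation ℤ (MvPowerSeries (Fin n) κ') (MvPowerSeries (Fin n) κ'),
      ∀ F, Δ' (MvPowerSeries.map lam F) = MvPowerSeries.map lam (Δ F) := by
  classical
  -- the candidate extension as a bare function, then as a `ℤ`-derivation (built by hand to stay clear of the `Algebra ℤ` instance diamond on power series)
  let T : MvPowerSeries (Fin n) κ' → MvPowerSeries (Fin n) κ' := fun G =>
    (∑ i : Fin n, MvPowerSeries.map lam (Δ (X i)) * MvPowerSeries.pderiv i G) +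
      ∑ l : Fin r, MvPowerSeries.map lam (Δ (C (γ l))) * (D' l).mvPowerSeriesCoeffwise G
  have hT : ∀ G, T G = (∑ i : Fin n, MvPowerSeries.map lam (Δ (X i)) * MvPowerSeries.pderiv i G) +
      ∑ l : Fin r, MvPowerSeries.map lam (Δ (C (γ l))) * (D' l).mvPowerSeriesCoeffwise G := fun G => rfl
  have hTadd : ∀ G H, T (G + H) = T G + T H := fun G H => by
    simp only [hT, map_add, mul_add, Finset.sum_add_distrib]; abel
  have hTleib : ∀ G H, T (G * H) = G * T H + H * T G := fun G H => by
    simp only [hT, Derivation.leibniz, smul_eq_mul, mul_add, Finset.sum_add_distrib, Finset.mul_sum]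
    have e1 : ∀ i : Fin n, MvPowerSeries.map lam (Δ (X i)) * (G * MvPowerSeries.pderiv i H) =
        G * (MvPowerSeries.map lam (Δ (X i)) * MvPowerSeries.pderiv i H) := fun i => by ring
    have e2 : ∀ i : Fin n, MvPowerSeries.map lam (Δ (X i)) * (H * MvPowerSeries.pderiv i G) =
        H * (MvPowerSeries.map lam (Δ (X i)) * MvPowerSeries.pderiv i G) := fun i => by ring
    have e3 : ∀ l : Fin r, MvPowerSeries.map lam (Δ (C (γ l))) * (G * (D' l).mvPowerSeriesCoeffwise H) =
        G * (MvPowerSeries.map lam (Δ (C (γ l))) * (D' l).mvPowerSeriesCoeffwise H) := fun l => by ring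
    have e4 : ∀ l : Fin r, MvPowerSeries.map lam (Δ (C (γ l))) * (H * (D' l).mvPowerSeriesCoeffwise G) =
        H * (MvPowerSeries.map lam (Δ (C (γ l))) * (D' l).mvPowerSeriesCoeffwise G) := fun l => by ring
    simp only [e1, e2, e3, e4]
    abel
  refine ⟨{ toFun := T
            map_add' := hTadd
            map_smul' := fun z G => by
              change T (z • G) = z • T G
              exact map_zsmul (AddMonoidHom.mk' T hTadd) z G
            map_one_eq_zero' := by
              change T 1 = 0
              have h := hTleib 1 1
              simp only [one_mul] at h
              -- `T 1 = T 1 + T 1`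
              have : T 1 + T 1 = T 1 + 0 := by rw [add_zero]; exact h.symm
              exact add_left_cancel this
            leibniz' := fun G H => by
              change T (G * H) = G • T H + H • T G
              rw [smul_eq_mul, smul_eq_mul]; exact hTleib G H }, fun F => ?_⟩
  change T (MvPowerSeries.map lam F) = MvPowerSeries.map lam (Δ F)
  rw [hT, derivation_apply_eq_sum_frame p γ D hdual hgen Δ F]
  simp only [map_add, map_sum, map_mul, smul_eq_mul]
  congr 1
  · refine Finset.sum_congr rfl fun i _ => ?_
    rw [← map_pderiv, mul_comm]
  · refine Finset.sum_congr rfl fun l _ => ?_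
    rw [← map_mvPowerSeriesCoeffwise lam (D l) (D' l) (hD' l), mul_comm]

end Summit.ResolutionOfSingularities.ResolutionOfSingularities.Theorems.SwitchingDichotomy.PowerSeriesDerivExt

end
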